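import Summits.ValiantsHypothesis.ValiantsHypothesis.Theses.DefinabilityGap
import Summits.ValiantsHypothesis.ValiantsHypothesis.Theorems.DefinabilityGapK2cPFamilyRung
import Summits.ValiantsHypothesis.ValiantsHypothesis.Theorems.DefinabilityGapWeakToK1ws
import Summits.ValiantsHypothesis.ValiantsHypothesis.Theorems.DefinabilityGapK2cIntegralRung
import Literature.Barriers.ValiantsHypothesis.CT23Lemma47Holds
import Literature.Barriers.ValiantsHypothesis.CT23ProjCircuitInputNormalisation

/-!
# DefinabilityGap — K2c rung 4: integer, constant-free, MULTILINEAR `VPSPACE⁰_b` annihilators of the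
# planted Kabanets–Impagliazzo map (Chatterjee–Tengse's integer engine, the tree's `CT23Lemma47.intEngine`)

Route `DefinabilityGap` (`Theses/DefinabilityGap.lean`), crux K2c `KIAnnihilatorDefinableOnCollapse`
(`stmt-ValiantsHypothesis-23546`). Rungs so far (same seat): p-family (`k2c_pFamily_rung`), integer p-family
(`k2c_integral_rung`), projection circuits over `ℂ` (`DefinabilityGapK2cProjRung.k2c_proj_rung`, CT23 Thm. 3.1).
THIS FILE, rung 4, UNCONDITIONAL and sharper on three counts: the annihilator family `A_m` of
`G_m = kiPer m` is (i) INTEGER, (ii) computed by CONSTANT-FREE (sign-constant) fan-in-two projection circuits of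
p-bounded size and workspace — i.e. `A ∈ VPSPACE⁰_b` in the tree's typed sense `IsVPSPACE0bFamily`, the class
of `CT23SuccinctHittingSetsVersusVPSPACE` and of route BarrierLever's theorems — and (iii) MULTILINEAR.

## Proof

No encoder is needed: the integer engine `CT23Lemma47.intEngine` (CT23 Thm. 3.1 run over `ℚ` at box side 2,
sign-constant, descended to `ℤ`; a tree theorem) takes the `n' = q³` output circuits directly. Block `c` of the
integer planted map is `per_m` renamed onto the cells `S_c ∘ permPad` of the `q × q` grid, so its circuit is
PER's constant-free projection circuit (`isVPSPACE0Family_perPoly`) renamed (`ProjCircuit.renameCircuit`),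
input-normalised (`ProjCircuit.exists_inputFree_sum`: projections on workspace only) and workspace-compressed
(`ProjCircuit.compress`) to a uniform workspace `Fin (3s+2)`, `s = 17·|C_m| + 5`. The engine's box condition
`(q³·m + 1)^{q²} < 2^{q³}` holds once `q ≥ 17` (`box_lt`, from `q⁴ < 2^q`), i.e. for `m ≥ 4`. The output —
`A ≠ 0` multilinear on `Fin (q³)` with `A ∘ G = 0` over `ℤ` and a sign-constant projection circuit of size and
workspace `≤ ((q³+1)(q²+1)(m+1)(s+1))^{c_E}` — is transported to `Fin 3 → Fin q` and base-changed to `ℂ`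
(`map_bind₁`, `map_kiPerK`). Corollary (`exists_isVPSPACE0bFamily_not_isVPFamily_of_kiPlantedHitting`): crux K1
implies `VPSPACE⁰_b ⊄ VP_ℂ` in EXACTLY the typed shape of the tree's
`exists_isVPSPACE0bFamily_not_isVPFamily_of_succinctHittingSetsForVP` (there from hitting sets for all of `VP`,
here from the one explicit generator).

Honest framing: a CONSEQUENCE-side rung (no hypothesis), strictly below K2c (which asks `VNP` under the
collapse); it is NOT a lower bound and `VP ≠ VNP` is NOT proved.

## References

* [ChatterjeeTengse2023] P. Chatterjee, A. Tengse, *Lower Bounds from Succinct Hitting Sets*, arXiv:2309.07612v2,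
  Thm. 3.1 with §3.3 ("moreover, constant-free") and Lemma 4.7 (the tree's `CT23Lemma47.intEngine`), Lemma 3.5
  (input normalisation), Thm. 1.4 (the shape of the corollary).
* [KabanetsImpagliazzo2003] V. Kabanets, R. Impagliazzo, *Derandomizing polynomial identity tests means proving
  circuit lower bounds*, STOC 2003, Thm. 7.7 (the generator).
-/

noncomputable section

open MvPolynomial
open Literature.Computability.AlgebraicComplexity
open Literature.Barriers.ValiantsHypothesis
open Summit.ValiantsHypothesis.ValiantsHypothesis.Theorems.DefinabilityGapAffineRung (qOf qOf_spec sq_le_qOf quadDesign kiPer)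
open Summit.ValiantsHypothesis.ValiantsHypothesis.Theorems.DefinabilityGapK2cPFamilyRung (isPBounded_qOf_pow totalDegree_le_card_mul_of_degreeOf_le)
open Summit.ValiantsHypothesis.ValiantsHypothesis.Theorems.DefinabilityGapWeakToK1ws (isPBounded_qOf)
open Summit.ValiantsHypothesis.ValiantsHypothesis.Theorems.DefinabilityGapK2cIntegralRung (map_kiPerK)
open Summit.ValiantsHypothesis.ValiantsHypothesis.Theses.DefinabilityGap (KIPlantedHitting)

namespace Summit.ValiantsHypothesis.ValiantsHypothesis.Theorems.DefinabilityGapK2cVPSPACE0Rung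

/-- `q⁴ < 2^q` for `q ≥ 17`. [folklore] -/
theorem pow_four_lt_two_pow {q : ℕ} (hq : 17 ≤ q) : q ^ 4 < 2 ^ q := by
  induction q, hq using Nat.le_induction with
  | base => norm_num
  | succ n hn ih =>
    have h3 : 17 * n ^ 3 ≤ n ^ 4 := by
      calc 17 * n ^ 3 ≤ n * n ^ 3 := Nat.mul_le_mul_right _ hn
        _ = n ^ 4 := by ring
    have h2 : n ^ 2 ≤ n ^ 3 := Nat.pow_le_pow_right (by omega) (by norm_num)
    have h1 : n ≤ n ^ 3 := by
      calc n = n ^ 1 := (pow_one n).symm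
        _ ≤ n ^ 3 := Nat.pow_le_pow_right (by omega) (by norm_num)
    have h0 : 1 ≤ n ^ 3 := Nat.one_le_pow _ _ (by omega)
    have heq : (n + 1) ^ 4 = n ^ 4 + 4 * n ^ 3 + 6 * n ^ 2 + 4 * n + 1 := by ring
    calc (n + 1) ^ 4 ≤ 2 * n ^ 4 := by rw [heq]; linarith
      _ < 2 * 2 ^ n := by linarith
      _ = 2 ^ (n + 1) := by ring

/-- **The engine's box condition for the planted map**: `(q³·m + 1)^{q²} < 2^{q³}` once `q ≥ 17` and
`m + 1 ≤ q`. [cite: ChatterjeeTengse2023, Lemma 4.7 (the hypothesis `(n'd+1)^m < 2^{n'}`)] -/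
theorem box_lt {q m : ℕ} (hq : 17 ≤ q) (hm : m + 1 ≤ q) :
    (q ^ 3 * m + 1) ^ (q * q) < 2 ^ (q ^ 3) := by
  have h1 : q ^ 3 * m + 1 ≤ q ^ 4 := by
    have hq3 : 1 ≤ q ^ 3 := Nat.one_le_pow _ _ (by omega)
    calc q ^ 3 * m + 1 ≤ q ^ 3 * m + q ^ 3 := by omega
      _ = q ^ 3 * (m + 1) := by ring
      _ ≤ q ^ 3 * q := Nat.mul_le_mul_left _ hm
      _ = q ^ 4 := by ring
  have hqq : q * q ≠ 0 := by positivity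
  calc (q ^ 3 * m + 1) ^ (q * q) ≤ (q ^ 4) ^ (q * q) := Nat.pow_le_pow_left h1 _
    _ < (2 ^ q) ^ (q * q) := Nat.pow_lt_pow_left (pow_four_lt_two_pow hq) hqq
    _ = 2 ^ (q ^ 3) := by rw [← pow_mul, show q * (q * q) = q ^ 3 by ring]

/-- **K2c rung 4 — `VPSPACE⁰_b` annihilators, integer, constant-free, multilinear (unconditional).** There is an
INTEGER family `A_m ∈ ℤ[z_c : c ∈ 𝔽_q³]` in `VPSPACE⁰_b` (`IsVPSPACE0bFamily`: sign-constant fan-in-two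
projection circuits of p-bounded size and workspace, p-bounded degree), MULTILINEAR, with `A_m ≠ 0` and
`A_m ∘ G_m = 0` over `ℂ` for all `m ≥ 4`.
[cite: ChatterjeeTengse2023, Thm. 3.1, §3.3 and Lemma 4.7; KabanetsImpagliazzo2003, Thm. 7.7] -/
theorem k2c_vpspace0b_rung :
    ∃ A : ∀ m : ℕ, MvPolynomial (Fin 3 → Fin (qOf m)) ℤ,
      IsVPSPACE0bFamily (σ := fun m => Fin 3 → Fin (qOf m)) A ∧ (∀ m j, (A m).degreeOf j ≤ 1) ∧
        ∃ m₁, ∀ m, m₁ ≤ m → A m ≠ 0 ∧ bind₁ (kiPer m) (map (Int.castRingHom ℂ) (A m)) = 0 := by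
  classical
  obtain ⟨-, tP, C, -, hC, hCsize⟩ := isVPSPACE0Family_perPoly
  obtain ⟨cE, hE⟩ := CT23Lemma47.intEngine
  have he : ∀ m, ∃ _e : (Fin 3 → Fin (qOf m)) ≃ Fin (qOf m ^ 3), True :=
    fun m => ⟨Fintype.equivFinOfCardEq (by simp [Fintype.card_fin]), trivial⟩
  choose e₃ _ using he
  -- the uniform size bound of the block circuits and the engine's output bound
  obtain ⟨s, hs⟩ : ∃ s : ℕ → ℕ, ∀ m, s m = 17 * (C m).size + 5 := ⟨_, fun _ => rfl⟩
  obtain ⟨B, hB⟩ : ∃ B : ℕ → ℕ, ∀ m, B m =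
      ((qOf m ^ 3 + 1) * (qOf m * qOf m + 1) * (m + 1) * (s m + 1)) ^ cE := ⟨_, fun _ => rfl⟩
  have key : ∀ m, ∃ (u : ℕ) (A : MvPolynomial (Fin 3 → Fin (qOf m)) ℤ)
      (Cq : ProjCircuit ℤ ((Fin 3 → Fin (qOf m)) ⊕ Fin u)),
      Cq.IsFanInTwo ∧ Cq.HasSignConstants ∧ Cq.Computes (rename Sum.inl A) ∧ u ≤ B m ∧
        Cq.size ≤ B m ∧ (∀ j, A.degreeOf j ≤ 1) ∧
        (4 ≤ m → A ≠ 0 ∧ bind₁ (kiPer m) (map (Int.castRingHom ℂ) A) = 0) := by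
    intro m
    by_cases hm : 4 ≤ m
    · have hq : m * m + 1 ≤ qOf m := (qOf_spec m).1
      have hq17 : 17 ≤ qOf m := by nlinarith
      have hm1 : 1 ≤ m := by omega
      have hmq : m + 1 ≤ qOf m := by nlinarith
      -- the integer blocks, flattened to `Fin (q·q)` seed variables
      obtain ⟨Gz, hGz⟩ : ∃ Gz : (Fin 3 → Fin (qOf m)) → MvPolynomial (Fin (qOf m * qOf m)) ℤ,
          ∀ c, Gz c = rename finProdFinEquiv
            (kiGenerator (perPad ℤ (sq_le_qOf m)) (quadDesign m) c) := ⟨_, fun _ => rfl⟩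
      have hGdeg : ∀ c, (Gz c).totalDegree ≤ m := fun c => by
        rw [hGz]
        exact (totalDegree_rename_le _ _).trans
          ((totalDegree_rename_le _ _).trans (totalDegree_perPad_le _))
      -- block circuits: PER's constant-free projection circuit renamed onto block `c`, input-normalised and
      -- workspace-compressed to the uniform workspace `Fin (3·s + 2)`
      have hblk : ∀ c, ∃ Q2 : ProjCircuit ℤ (Fin (qOf m * qOf m) ⊕ Fin (3 * s m + 2)),
          Q2.IsFanInTwo ∧ Q2.HasSignConstants ∧ Q2.Computes (rename Sum.inl (Gz c)) ∧
            Q2.size ≤ s m ∧ Q2.projVars ⊆ Set.range Sum.inr := by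
        intro c
        obtain ⟨g, hg⟩ : ∃ g : Fin m × Fin m → Fin (qOf m * qOf m),
            ∀ ab, g ab = finProdFinEquiv (quadDesign m c (permPad (sq_le_qOf m) ab)) := ⟨_, fun _ => rfl⟩
        have hginj : Function.Injective g := fun a b h => by
          rw [hg, hg] at h
          exact (permPad (sq_le_qOf m)).injective ((quadDesign m c).injective (finProdFinEquiv.injective h))
        have hinj : Function.Injective (Sum.map g (id : Fin (tP m) → Fin (tP m))) :=
          Sum.map_injective.2 ⟨hginj, Function.injective_id⟩
        have h0fan : ((C m).renameCircuit (Sum.map g id)).IsFanInTwo :=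
          ProjCircuit.isFanInTwo_renameCircuit (hC m).1 _
        have h0sign : ((C m).renameCircuit (Sum.map g id)).HasSignConstants :=
          ProjCircuit.hasSignConstants_renameCircuit (hC m).2.1 _
        have h0comp : ((C m).renameCircuit (Sum.map g id)).Computes (rename Sum.inl (Gz c)) := by
          rw [ProjCircuit.Computes, ProjCircuit.eval_renameCircuit _ hinj,
            show (C m).eval = _ from (hC m).2.2, rename_rename, hGz, kiGenerator_apply, perPad,
            rename_rename, rename_rename, rename_rename]
          exact congrArg (fun F => rename F (perPoly (Fin m) ℤ)) (funext fun ab => by simp [hg])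
        have h0size : ((C m).renameCircuit (Sum.map g id)).size = (C m).size :=
          ProjCircuit.size_renameCircuit _ _
        obtain ⟨w', Q1, h1fan, h1comp, h1size, h1sign, h1proj⟩ :=
          ProjCircuit.exists_inputFree_sum _ h0fan (Gz c) h0comp
        have hW : Q1.touchedWork.card + 1 ≤ 3 * s m + 2 := by
          have := ProjCircuit.card_touchedWork_le h1fan
          rw [hs]; omega
        refine ⟨Q1.compress hW, ProjCircuit.isFanInTwo_compress Q1 hW h1fan,
          ProjCircuit.hasSignConstants_compress Q1 hW (h1sign h0sign),
          ProjCircuit.eval_compress Q1 hW (Gz c) h1comp, ?_, ProjCircuit.projVars_compress_subset Q1 hW h1proj⟩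
        rw [ProjCircuit.size_compress, hs]; omega
      choose Qb hQb using hblk
      -- the integer engine on the `q³` block circuits
      have h2n : 2 ≤ qOf m ^ 3 :=
        calc 2 ≤ 17 ^ 3 := by norm_num
          _ ≤ qOf m ^ 3 := Nat.pow_le_pow_left hq17 3
      have hm' : 1 ≤ qOf m * qOf m := by nlinarith
      have hs1 : 1 ≤ s m := by rw [hs]; omega
      obtain ⟨u, A, Q', hA0, hAdeg, hann, hfan, hsign, hcomp, hu, hsize⟩ :=
        hE (qOf m ^ 3) (qOf m * qOf m) m (s m) (3 * s m + 2)
          (fun i => Gz ((e₃ m).symm i)) (fun i => Qb ((e₃ m).symm i))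
          h2n hm' hm1 hs1 (fun i => hGdeg _) (box_lt hq17 hmq) (fun i => hQb _)
      -- transport to `Fin 3 → Fin q` and base-change the annihilation to `ℂ`
      have hinj3 : Function.Injective (Sum.map (e₃ m).symm (id : Fin u → Fin u)) :=
        Sum.map_injective.2 ⟨(e₃ m).symm.injective, Function.injective_id⟩
      refine ⟨u, rename (e₃ m).symm A, Q'.renameCircuit (Sum.map (e₃ m).symm id),
        ProjCircuit.isFanInTwo_renameCircuit hfan _, ProjCircuit.hasSignConstants_renameCircuit hsign _,
        ?_, by rw [hB]; exact hu, by rw [ProjCircuit.size_renameCircuit, hB]; exact hsize, fun j => ?_,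
        fun _ => ⟨fun h0 => hA0 ?_, ?_⟩⟩
      · rw [ProjCircuit.Computes, ProjCircuit.eval_renameCircuit _ hinj3, show Q'.eval = _ from hcomp,
          rename_rename, rename_rename]
        rfl
      · have hj : j = (e₃ m).symm (e₃ m j) := ((e₃ m).symm_apply_apply j).symm
        rw [hj, degreeOf_rename_of_injective (e₃ m).symm.injective]
        exact hAdeg _
      · exact rename_injective _ (e₃ m).symm.injective (by rw [h0, map_zero])
      · have h1 : bind₁ (fun i => map (Int.castRingHom ℂ) (Gz ((e₃ m).symm i)))
            (map (Int.castRingHom ℂ) A) = 0 := by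
          have := congrArg (map (Int.castRingHom ℂ)) hann
          rwa [show aeval (fun i => Gz ((e₃ m).symm i)) A = bind₁ (fun i => Gz ((e₃ m).symm i)) A
            from rfl, map_bind₁, map_zero] at this
        have h2 : ∀ c, map (Int.castRingHom ℂ) (Gz c) = rename finProdFinEquiv (kiPer m c) := fun c => by
          rw [hGz, map_rename, map_kiPerK]
          rfl
        have h3 : bind₁ (fun i => map (Int.castRingHom ℂ) (Gz ((e₃ m).symm i))) (map (Int.castRingHom ℂ) A)
            = rename finProdFinEquiv
              (bind₁ (fun i => kiPer m ((e₃ m).symm i)) (map (Int.castRingHom ℂ) A)) := by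
          rw [rename_bind₁]
          exact congrArg (fun F => bind₁ F (map (Int.castRingHom ℂ) A)) (funext fun i => h2 _)
        have h4 : bind₁ (fun i => kiPer m ((e₃ m).symm i)) (map (Int.castRingHom ℂ) A) = 0 :=
          rename_injective _ finProdFinEquiv.injective (by rw [← h3, h1, map_zero])
        rw [map_rename, bind₁_rename]
        exact h4
    · -- below the threshold: the zero polynomial with the constant-free circuit `0`
      refine ⟨0, 0, ProjCircuit.ofArithCircuit (ArithCircuit.ofConst 0), ?_, ?_, ?_, Nat.zero_le _, ?_,
        fun j => by rw [degreeOf_zero]; exact Nat.zero_le _, fun h => absurd h hm⟩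
      · intro g hg
        simp [ProjCircuit.ofArithCircuit, ArithCircuit.ofConst] at hg
      · refine ProjCircuit.hasSignConstants_ofArithCircuit ⟨?_, ?_⟩
        · intro g hg
          simp [ArithCircuit.ofConst] at hg
        · show ArithCircuit.IsSignConstant (0 : ℤ)
          exact Or.inl rfl
      · show (ProjCircuit.ofArithCircuit (ArithCircuit.ofConst (0 : ℤ))).eval = rename Sum.inl 0
        rw [ProjCircuit.eval_ofArithCircuit, ArithCircuit.eval_ofConst, map_zero, map_zero]
      · rw [ProjCircuit.size_ofArithCircuit, ArithCircuit.size_ofConst]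
        exact Nat.zero_le _
  choose u A Cq hfan hsign hcomp hu hsize hdeg hgood using key
  have hsB : IsPBounded s := by
    refine IsPBounded.mono (t := fun m => 17 * (C m).size + 5) ?_ (fun m => (hs m).le)
    exact IsPBounded.add_holds (IsPBounded.mul_holds (IsPBounded.const 17) hCsize) (IsPBounded.const 5)
  have hBB : IsPBounded B := by
    refine IsPBounded.mono
      (t := fun m => ((qOf m ^ 3 + 1) * (qOf m * qOf m + 1) * (m + 1) * (s m + 1)) ^ cE) ?_
      (fun m => (hB m).le)
    exact IsPBounded.pow_holds (IsPBounded.mul_holds (IsPBounded.mul_holds (IsPBounded.mul_holds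
      (IsPBounded.add_holds (isPBounded_qOf_pow 3) (IsPBounded.const 1))
      (IsPBounded.add_holds (IsPBounded.mul_holds isPBounded_qOf isPBounded_qOf) (IsPBounded.const 1)))
      (IsPBounded.add_holds IsPBounded.id (IsPBounded.const 1)))
      (IsPBounded.add_holds hsB (IsPBounded.const 1))) cE
  refine ⟨A, ⟨⟨?_, u, Cq, hBB.mono hu, fun m => ⟨hfan m, hsign m, hcomp m⟩, hBB.mono hsize⟩, ?_⟩, hdeg, 4,
    fun m hm => hgood m hm⟩
  · exact (isPBounded_qOf_pow 3).mono fun m => by simp [Fintype.card_fin]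
  · refine IsPBounded.mono (t := fun m => qOf m ^ 3 * 1)
      (IsPBounded.mul_holds (isPBounded_qOf_pow 3) (IsPBounded.const 1)) fun m => ?_
    exact (totalDegree_le_card_mul_of_degreeOf_le (hdeg m)).trans (le_of_eq (by simp [Fintype.card_fin]))

/-- **`KIPlantedHitting ⟹ VPSPACE⁰_b ⊄ VP_ℂ`**, in exactly the typed shape of the tree's
`exists_isVPSPACE0bFamily_not_isVPFamily_of_succinctHittingSetsForVP` (CT23 Thm. 1.4, there from `VP`-succinct
hitting sets for ALL of `VP`; here from the ONE explicit planted generator of crux K1): the rung-4 annihilator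
family is an integer `VPSPACE⁰_b` family whose complexification is not in `VP_ℂ`.
[cite: ChatterjeeTengse2023, Thm. 1.4 and Thm. 4.1 (i); KabanetsImpagliazzo2003, Thm. 7.7] -/
theorem exists_isVPSPACE0bFamily_not_isVPFamily_of_kiPlantedHitting (hK1 : KIPlantedHitting) :
    ∃ A : ∀ m : ℕ, MvPolynomial (Fin 3 → Fin (qOf m)) ℤ,
      IsVPSPACE0bFamily (σ := fun m => Fin 3 → Fin (qOf m)) A ∧
        ¬ IsVPFamily (fun m => map (Int.castRingHom ℂ) (A m)) := by
  obtain ⟨A, hA, -, m₁, hann⟩ := k2c_vpspace0b_rung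
  refine ⟨A, hA, fun hVP => ?_⟩
  obtain ⟨c₁, hc₁⟩ := hVP.2
  obtain ⟨c₂, hc₂⟩ := hVP.1.2
  obtain ⟨m, hm, hhit⟩ := hK1 (max c₁ c₂ + 1) m₁
  have hq1 : 1 ≤ qOf m := (qOf_spec m).2.one_lt.le
  -- `m^c + c ≤ q(m)^(c+1)` (as in `DefinabilityGapK1SeparatesProj.pow_add_le_qOf_pow`)
  have pow_add_le_qOf_pow : ∀ m c : ℕ, m ^ c + c ≤ qOf m ^ (c + 1) := fun m c => by
    have hq : m * m + 1 ≤ qOf m := (qOf_spec m).1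
    have hq2 : 2 ≤ qOf m := (qOf_spec m).2.two_le
    have hmq : m ≤ qOf m := by nlinarith
    have h1 : m ^ c ≤ qOf m ^ c := Nat.pow_le_pow_left hmq c
    have h2 : c ≤ qOf m ^ c :=
      (Nat.lt_pow_self (by omega : 1 < 2)).le.trans (Nat.pow_le_pow_left hq2 c)
    calc m ^ c + c ≤ qOf m ^ c + qOf m ^ c := add_le_add h1 h2
      _ = 2 * qOf m ^ c := by ring
      _ ≤ qOf m * qOf m ^ c := Nat.mul_le_mul_right _ hq2
      _ = qOf m ^ (c + 1) := by ring
  have hmono : ∀ c, c ≤ max c₁ c₂ → qOf m ^ (c + 1) ≤ qOf m ^ (max c₁ c₂ + 1) := fun c hc =>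
    Nat.pow_le_pow_right hq1 (by omega)
  have hcx : complexity (map (Int.castRingHom ℂ) (A m)) ≤ qOf m ^ (max c₁ c₂ + 1) :=
    ((hc₁ m).trans (pow_add_le_qOf_pow m c₁)).trans (hmono c₁ (le_max_left _ _))
  have hdeg : (map (Int.castRingHom ℂ) (A m)).totalDegree ≤ qOf m ^ (max c₁ c₂ + 1) :=
    ((hc₂ m).trans (pow_add_le_qOf_pow m c₂)).trans (hmono c₂ (le_max_right _ _))
  have hne : map (Int.castRingHom ℂ) (A m) ≠ 0 := fun h0 =>
    (hann m hm).1 (map_injective _ (Int.castRingHom ℂ).injective_int (by rw [h0, map_zero]))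
  exact hhit _ hne hcx hdeg (hann m hm).2

end Summit.ValiantsHypothesis.ValiantsHypothesis.Theorems.DefinabilityGapK2cVPSPACE0Rung

end
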